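import Summits.BirchSwinnertonDyer.BirchSwinnertonDyer.Theorems.CyclotomicUntwistSigmaLineFamilyExpRepresentation
import Summits.BirchSwinnertonDyer.BirchSwinnertonDyer.Theorems.CyclotomicUntwistSigmaLineFamilyEvaluation
import Literature.NumberTheory.EllipticCurves.FormalGroupDictionaryProofs
import Mathlib.Analysis.Normed.Group.Ultra
import HarnessLib

/-!
# Route `CyclotomicUntwist`, crux K1 `PSRankOneLowerHalfAtThree` (stmt-BirchSwinnertonDyer-21580):
# the σ-LINE FAMILY — CRUDE BERNARDI CONVERGENCE: `σ_c(p²t) ∈ ℤ_p⟦t⟧` for every `‖c‖ ≤ 1`, so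
# `σ_c` converges absolutely on `p²·(open unit disc)` with `‖σ_c(t)‖ = ‖t‖` (non-vanishing)

Cell `pub/bsd-wall` (D-0145 line `route-BirchSwinnertonDyer-CyclotomicUntwist`), seat `bsd-line-cycu-p1`
g4 (K1 base). THEOREMS ONLY (no definition, no named fact, no `sorry`); helper `--supports` K1 =
stmt-BirchSwinnertonDyer-21580. Sequel of `…SigmaLineFamilyExpRepresentation.lean` (`σ_c = t·exp(Ψ)`) and
`…SigmaLineFamilyEvaluation.lean` (dilation, `exp(pX) ∈ ℤ_p⟦X⟧`). It DISCHARGES, for every member of the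
formal sigma family with INTEGRAL constant on a `p`-integral equation (in particular the minimal model of
the route's curves at the ADDITIVE prime `3`, where no Mazur–Tate `σ_p` exists), the two analytic
hypotheses of the height difference law and of the Perrin-Riou dichotomy
(`…SigmaLineFamilyValues.lean`): absolute convergence `Summable ‖[tⁿ]σ·tⁿ‖` and `σ(t) ≠ 0`, at every
parameter `t ∈ p²·(open unit disc)`. BSD is not proved by this file and nothing here is evidence for or
against K1/K2; the census cell's caveat "Bernardi quadraticity of σ_c-heights at an additive prime is not a
tree theorem" keeps its QUADRATICITY half (the formal half is `thetaLHS_formalSigma_eq_thetaRHS`).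

The bounds (V `p`-integral, `‖c‖ ≤ 1`; `h = ω(t²x + ct²) ∈ ℤ_p⟦t⟧`): `‖gₙ‖ ≤ n + 1`
(`gₙ = −hₙ/(n−1)`, `|1/(n−1)| ≤ n−1`; `g₁ = −a₁/2`), `‖Gₙ‖ ≤ n + 1` (`G = gω`, ultrametric),
`‖p^{2n−1}Ψₙ‖ = ‖p^{2n−1}Gₙ/n‖ ≤ p^{1−2n}·n(n+1) ≤ 1` (`n(n+1) ≤ 2^{2n−1}`), i.e.
`Θ := p⁻¹Ψ(p²t) ∈ tℤ_p⟦t⟧`; then `σ_c(p²t) = p²t·F(Θ(t))` with `F = exp(pX) ∈ ℤ_p⟦X⟧`. The radius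
`|t| < p⁻²` is CRUDE (Bernardi: `v(t) > 1/(p−1)`); it suffices, heights being read on multiples `mP`.

* `exists_dilation_formalSigma`, `isPadicInt_rescale_formalSigma` (`‖[tⁿ]σ_c‖ ≤ p^{2n}`),
  `summable_norm_formalSigma`, `exists_padicEval_formalSigma_eq` (`σ_c(p²u) = p²u·exp_p(pθ)`, `|θ| < 1`),
  `norm_padicEval_formalSigma` (`‖σ_c(t)‖ = ‖t‖`), `padicEval_formalSigma_ne_zero`.

References: Bernardi, Progr. Math. 12 (1981) §1 (convergence of `σ`); Mazur–Tate, Duke Math. J. 62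
(1991) §3; Mazur–Stein–Tate 2006 §3.1; Robert GTM 198 Ch. V §4.1–4.2; Silverman AEC IV.6.
[cite: MazurTate1991, Thm. 3.1] [cite: MazurSteinTate2006, Thm. 1.3] [cite: Robert2000PadicAnalysis, Ch. V §4.2 Proposition 1]
-/

set_option autoImplicit false
set_option linter.dupNamespace false

noncomputable section

open scoped Classical Nat

open PowerSeries WeierstrassCurve Literature.NumberTheory.EllipticCurves Literature.RingTheory.FormalGroups
  Literature.NumberTheory.LocalFields

namespace Summit.BirchSwinnertonDyer.BirchSwinnertonDyer.Theorems.PSSigmaLineFamilyConvergence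

open Summit.BirchSwinnertonDyer.BirchSwinnertonDyer.Theorems.PSSigmaLineFamily
  Summit.BirchSwinnertonDyer.BirchSwinnertonDyer.Theorems.PSSigmaLineFamilyEvaluation
  Summit.BirchSwinnertonDyer.BirchSwinnertonDyer.Theorems.PSSigmaLineFamilyExpRepresentation

variable {p : ℕ} [Fact p.Prime] (V : WeierstrassCurve ℚ_[p])

/-! ### §4 Bounds: `p⁻¹·Ψ(p²t) ∈ ℤ_p⟦t⟧`, hence `σ_c(p²t) ∈ ℤ_p⟦t⟧` (crude Bernardi convergence) -/

section Bounds

variable [V.IsIntegral ℤ_[p]]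

/-- `h = ω(t²x + ct²) ∈ ℤ_p⟦t⟧` for a `p`-integral equation and `‖c‖ ≤ 1`. [folklore] -/
theorem isPadicInt_rhs {c : ℚ_[p]} (hc : ‖c‖ ≤ 1) :
    IsPadicInt (V.formalOmega * (V.formalXMulSq + C c * X ^ 2)) :=
  V.isPadicInt_formalOmega.mul
    (V.isPadicInt_formalXMulSq.add (isPadicInt_C_mul hc (IsPadicInt.powerSeries_X.pow 2)))

/-- `‖((n : ℚ_p) − 1)⁻¹‖ ≤ n − 1 ≤ n + 1` bookkeeping: `‖(m : ℚ_p)⁻¹‖ ≤ m`. [folklore] -/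
theorem norm_inv_natCast_sub_one_le {n : ℕ} (hn : 2 ≤ n) : ‖((n : ℚ_[p]) - 1)⁻¹‖ ≤ (n : ℝ) + 1 := by
  obtain ⟨m, rfl⟩ := Nat.exists_eq_add_of_le hn
  have h : ((2 + m : ℕ) : ℚ_[p]) - 1 = ((m + 1 : ℕ) : ℚ_[p]) := by push_cast; ring
  rw [h]
  calc ‖(((m + 1 : ℕ) : ℚ_[p]))⁻¹‖ ≤ (m + 1 : ℕ) := padic_norm_inv_natCast_le _
    _ ≤ ((2 + m : ℕ) : ℝ) + 1 := by push_cast; linarith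

/-- **Coefficient bound for `g`**: `‖gₙ‖ ≤ n + 1` (`g₀ = 1`, `g₁ = −a₁/2`, `gₙ = −hₙ/(n−1)`, `h`
integral). [Bernardi 1981; Mazur–Tate 1991, §3] [folklore] -/
theorem norm_coeff_g_le {c : ℚ_[p]} (hc : ‖c‖ ≤ 1) {g : ℚ_[p]⟦X⟧} (hg0 : constantCoeff g = 1)
    (hg1 : coeff 1 g = -(V.a₁ / 2))
    (hgn : ∀ n : ℕ, 2 ≤ n → coeff n g =
      -(coeff n (V.formalOmega * (V.formalXMulSq + C c * X ^ 2))) / ((n : ℚ_[p]) - 1))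
    (n : ℕ) : ‖coeff n g‖ ≤ (n : ℝ) + 1 := by
  rcases Nat.lt_or_ge n 2 with hlt | hge
  · interval_cases n
    · rw [coeff_zero_eq_constantCoeff_apply, hg0, norm_one]; norm_num
    · rw [hg1, norm_neg, norm_div]
      have ha : ‖V.a₁‖ ≤ 1 := V.norm_coeffs_le_one.1
      have h2 : ‖(2 : ℚ_[p])‖⁻¹ ≤ 2 := by
        rw [← norm_inv]; exact_mod_cast padic_norm_inv_natCast_le (p := p) 2
      rw [div_eq_mul_inv]
      calc ‖V.a₁‖ * ‖(2 : ℚ_[p])‖⁻¹ ≤ 1 * 2 := by gcongr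
        _ = (1 : ℕ) + 1 := by norm_num
  · rw [hgn n hge, norm_div, norm_neg]
    have hh : ‖coeff n (V.formalOmega * (V.formalXMulSq + C c * X ^ 2))‖ ≤ 1 :=
      isPadicInt_iff_coeff.mp (isPadicInt_rhs V hc) n
    rw [div_eq_mul_inv, ← norm_inv]
    calc _ ≤ 1 * ((n : ℝ) + 1) := by gcongr; exact norm_inv_natCast_sub_one_le hge
      _ = _ := one_mul _

/-- **Coefficient bound for `G = g·ω`**: `‖Gₙ‖ ≤ n + 1` (ultrametric sum, `ω` integral). [folklore] -/
theorem norm_coeff_g_mul_formalOmega_le {c : ℚ_[p]} (hc : ‖c‖ ≤ 1) {g : ℚ_[p]⟦X⟧} (hg0 : constantCoeff g = 1)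
    (hg1 : coeff 1 g = -(V.a₁ / 2))
    (hgn : ∀ n : ℕ, 2 ≤ n → coeff n g =
      -(coeff n (V.formalOmega * (V.formalXMulSq + C c * X ^ 2))) / ((n : ℚ_[p]) - 1))
    (n : ℕ) : ‖coeff n (g * V.formalOmega)‖ ≤ (n : ℝ) + 1 := by
  rw [coeff_mul]
  refine IsUltrametricDist.norm_sum_le_of_forall_le_of_nonneg (by positivity) fun kl hkl => ?_
  rw [Finset.HasAntidiagonal.mem_antidiagonal] at hkl
  rw [norm_mul]
  have h1 := norm_coeff_g_le V hc hg0 hg1 hgn kl.1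
  have h2 : ‖coeff kl.2 V.formalOmega‖ ≤ 1 := isPadicInt_iff_coeff.mp V.isPadicInt_formalOmega _
  have h3 : (kl.1 : ℝ) ≤ n := by exact_mod_cast (hkl ▸ Nat.le_add_right kl.1 kl.2)
  calc ‖coeff kl.1 g‖ * ‖coeff kl.2 V.formalOmega‖ ≤ ((kl.1 : ℝ) + 1) * 1 := by
        gcongr
    _ ≤ (n : ℝ) + 1 := by linarith

/-- `n(n+1) ≤ p^{2n−1}` for `n ≥ 1` (real form; `≤ 2^{2n−1}` by induction). [folklore] -/
theorem natCast_mul_succ_le_prime_pow {n : ℕ} (hn : 1 ≤ n) : (n : ℝ) * ((n : ℝ) + 1) ≤ (p : ℝ) ^ (2 * n - 1) := by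
  have hp : 2 ≤ p := (Fact.out : p.Prime).two_le
  have h2 : n * (n + 1) ≤ 2 ^ (2 * n - 1) := by
    induction n with
    | zero => omega
    | succ m ih =>
      rcases Nat.eq_zero_or_pos m with rfl | hm
      · norm_num
      · have ih' := ih hm
        have e : 2 * (m + 1) - 1 = (2 * m - 1) + 2 := by omega
        rw [e, pow_add]
        nlinarith
  calc (n : ℝ) * ((n : ℝ) + 1) = ((n * (n + 1) : ℕ) : ℝ) := by push_cast; ring
    _ ≤ ((2 ^ (2 * n - 1) : ℕ) : ℝ) := by exact_mod_cast h2
    _ ≤ ((p ^ (2 * n - 1) : ℕ) : ℝ) := by exact_mod_cast Nat.pow_le_pow_left hp _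
    _ = (p : ℝ) ^ (2 * n - 1) := by push_cast; ring

/-- **`Θ := p⁻¹·Ψ(p²t) ∈ ℤ_p⟦t⟧`**: `‖p^{2n−1}·Gₙ/n‖ ≤ p^{1−2n}·n(n+1) ≤ 1`. [Bernardi 1981] [folklore] -/
theorem isPadicInt_dilatedPsi {c : ℚ_[p]} (hc : ‖c‖ ≤ 1) {g Ψ : ℚ_[p]⟦X⟧} (hg0 : constantCoeff g = 1)
    (hg1 : coeff 1 g = -(V.a₁ / 2))
    (hgn : ∀ n : ℕ, 2 ≤ n → coeff n g =
      -(coeff n (V.formalOmega * (V.formalXMulSq + C c * X ^ 2))) / ((n : ℚ_[p]) - 1))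
    (hΨ0 : constantCoeff Ψ = 0) (hΨn : ∀ n : ℕ, 1 ≤ n → coeff n Ψ = coeff n (g * V.formalOmega) / (n : ℚ_[p])) :
    IsPadicInt (C ((p : ℚ_[p]))⁻¹ * rescale ((p : ℚ_[p]) ^ 2) Ψ) := by
  have hp : p.Prime := Fact.out
  have hp0 : (p : ℚ_[p]) ≠ 0 := by exact_mod_cast hp.ne_zero
  have hpR : (0 : ℝ) < p := by exact_mod_cast hp.pos
  rw [isPadicInt_iff_coeff]
  intro n
  rw [coeff_C_mul, coeff_rescale]
  rcases Nat.eq_zero_or_pos n with rfl | hn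
  · rw [pow_zero, one_mul, coeff_zero_eq_constantCoeff_apply, hΨ0, mul_zero, norm_zero]; exact zero_le_one
  · rw [hΨn n hn]
    have hn0 : (n : ℚ_[p]) ≠ 0 := by exact_mod_cast hn.ne'
    have hrw : ((p : ℚ_[p]))⁻¹ * (((p : ℚ_[p]) ^ 2) ^ n * (coeff n (g * V.formalOmega) / (n : ℚ_[p]))) =
        (p : ℚ_[p]) ^ (2 * n - 1) * ((n : ℚ_[p]))⁻¹ * coeff n (g * V.formalOmega) := by
      have e : (2 * n - 1) + 1 = 2 * n := by omega
      have hpow : (p : ℚ_[p]) ^ (2 * n) = (p : ℚ_[p]) ^ (2 * n - 1) * p := by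
        rw [← pow_succ, e]
      rw [← pow_mul, mul_comm 2 n, show n * 2 = 2 * n by ring, hpow]
      field_simp
    rw [hrw, norm_mul, norm_mul, norm_pow, Padic.norm_p]
    have hG := norm_coeff_g_mul_formalOmega_le V hc hg0 hg1 hgn n
    have hinv := padic_norm_inv_natCast_le (p := p) n
    have hkey := natCast_mul_succ_le_prime_pow (p := p) hn
    calc ((p : ℝ)⁻¹) ^ (2 * n - 1) * ‖((n : ℚ_[p]))⁻¹‖ * ‖coeff n (g * V.formalOmega)‖
        ≤ ((p : ℝ)⁻¹) ^ (2 * n - 1) * (n : ℝ) * ((n : ℝ) + 1) := by gcongr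
      _ = ((p : ℝ) ^ (2 * n - 1))⁻¹ * ((n : ℝ) * ((n : ℝ) + 1)) := by rw [inv_pow]; ring
      _ ≤ ((p : ℝ) ^ (2 * n - 1))⁻¹ * (p : ℝ) ^ (2 * n - 1) := by gcongr
      _ = 1 := inv_mul_cancel₀ (pow_ne_zero _ hpR.ne')

omit [V.IsIntegral ℤ_[p]] in
/-- `exp(a·Θ) = (rescale a exp) ∘ Θ` for `Θ(0) = 0`. [folklore] -/
theorem exp_subst_C_mul (a : ℚ_[p]) {Θ : ℚ_[p]⟦X⟧} (hΘ : constantCoeff Θ = 0) :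
    (exp ℚ_[p]).subst (C a * Θ) = (rescale a (exp ℚ_[p])).subst Θ := by
  rw [rescale_eq_subst, subst_comp_subst_apply (HasSubst.smul_X' a) (HasSubst.of_constantCoeff_zero' hΘ),
    subst_smul (HasSubst.of_constantCoeff_zero' hΘ), subst_X (HasSubst.of_constantCoeff_zero' hΘ),
    smul_eq_C_mul]

/-- **CRUDE BERNARDI CONVERGENCE, integral form**: for a `p`-integral equation and `‖c‖ ≤ 1`,
`formalSigma V c (p²·t) = p²t · F(Θ(t))` with `F = exp(pX) ∈ ℤ_p⟦X⟧`, `Θ ∈ tℤ_p⟦t⟧`; in particular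
`σ_c(p²t) ∈ ℤ_p⟦t⟧`, i.e. `‖[tⁿ]σ_c‖ ≤ p^{2n}` — the sigma function of EVERY member with integral constant
converges on `p²·(open unit disc)` (Bernardi: on `v(t) > 1/(p−1)`; the crude radius suffices for heights,
which are read on multiples `mP` deep in the formal group). [Bernardi 1981, §1; Mazur–Tate 1991, §3]
[cite: MazurTate1991, Thm. 3.1] -/
theorem exists_dilation_formalSigma {c : ℚ_[p]} (hc : ‖c‖ ≤ 1) :
    ∃ Θ : ℚ_[p]⟦X⟧, IsPadicInt Θ ∧ constantCoeff Θ = 0 ∧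
      rescale ((p : ℚ_[p]) ^ 2) (V.formalSigma c) =
        C ((p : ℚ_[p]) ^ 2) * X * (rescale (p : ℚ_[p]) (exp ℚ_[p])).subst Θ := by
  have hp0 : (p : ℚ_[p]) ≠ 0 := by exact_mod_cast (Fact.out : p.Prime).ne_zero
  obtain ⟨g, Ψ, hg0, hg1, hgn, hΨ0, hΨn, hrep⟩ := exists_exp_representation V c
  set Θ := C ((p : ℚ_[p]))⁻¹ * rescale ((p : ℚ_[p]) ^ 2) Ψ with hΘ
  have hΘ0 : constantCoeff Θ = 0 := by
    rw [hΘ, map_mul, ← coeff_zero_eq_constantCoeff_apply (rescale _ _), coeff_rescale, pow_zero, one_mul,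
      coeff_zero_eq_constantCoeff_apply, hΨ0, mul_zero]
  have hresc : rescale ((p : ℚ_[p]) ^ 2) Ψ = C (p : ℚ_[p]) * Θ := by
    rw [hΘ, ← mul_assoc, ← map_mul, mul_inv_cancel₀ hp0, map_one, one_mul]
  refine ⟨Θ, isPadicInt_dilatedPsi V hc hg0 hg1 hgn hΨ0 hΨn, hΘ0, ?_⟩
  rw [hrep, map_mul, rescale_X, rescale_exp_subst _ hΨ0, hresc, exp_subst_C_mul _ hΘ0]

/-- **`‖[tⁿ] formalSigma V c‖ ≤ p^{2n}`**, i.e. `σ_c(p²t) ∈ ℤ_p⟦t⟧`, for `‖c‖ ≤ 1`.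
[Bernardi 1981, §1] [cite: MazurTate1991, Thm. 3.1] -/
theorem isPadicInt_rescale_formalSigma {c : ℚ_[p]} (hc : ‖c‖ ≤ 1) :
    IsPadicInt (rescale ((p : ℚ_[p]) ^ 2) (V.formalSigma c)) := by
  obtain ⟨Θ, hΘ, hΘ0, h⟩ := exists_dilation_formalSigma V hc
  have hp2 : ‖((p : ℚ_[p]) ^ 2)‖ ≤ 1 := by
    rw [norm_pow, Padic.norm_p]
    exact pow_le_one₀ (by positivity) (inv_le_one_of_one_le₀ (by exact_mod_cast (Fact.out : p.Prime).one_le))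
  rw [h, mul_assoc]
  exact isPadicInt_C_mul hp2 (IsPadicInt.powerSeries_X.mul
    (isPadicInt_rescale_exp.powerSeries_subst hΘ (HasSubst.of_constantCoeff_zero' hΘ0)))

/-- **Absolute convergence of `σ_c` on `p²·(open unit disc)`** (`‖c‖ ≤ 1`): the hypothesis
`Summable ‖[tⁿ]σ·tⁿ‖` of the height difference law / dichotomy (`CyclotomicUntwistSigmaLineFamilyValues`),
DISCHARGED for every member of the family with integral constant at `t = p²u`, `‖u‖ < 1`.
[Bernardi 1981, §1] [cite: MazurTate1991, Thm. 3.1] -/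
theorem summable_norm_formalSigma {c : ℚ_[p]} (hc : ‖c‖ ≤ 1) {u : ℚ_[p]} (hu : ‖u‖ < 1) :
    Summable fun n : ℕ => ‖coeff n (V.formalSigma c) * ((p : ℚ_[p]) ^ 2 * u) ^ n‖ := by
  have hfun : (fun n : ℕ => ‖coeff n (V.formalSigma c) * ((p : ℚ_[p]) ^ 2 * u) ^ n‖) =
      fun n : ℕ => ‖coeff n (rescale ((p : ℚ_[p]) ^ 2) (V.formalSigma c)) * u ^ n‖ :=
    funext fun n => by rw [term_rescale]
  rw [hfun]
  exact summable_norm_padicEval_of_isPadicInt (isPadicInt_rescale_formalSigma V hc) hu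

/-- **The value `σ_c(p²u) = p²u·exp_p(p·Θ(u))`**, with `‖Θ(u)‖ < 1`: a parameter times a principal
unit. [Bernardi 1981, §1; Robert 2000, Ch. V §4.2] [cite: Robert2000PadicAnalysis, Ch. V §4.2 Proposition 1] -/
theorem exists_padicEval_formalSigma_eq {c : ℚ_[p]} (hc : ‖c‖ ≤ 1) {u : ℚ_[p]} (hu : ‖u‖ < 1) :
    ∃ θ : ℚ_[p], ‖θ‖ < 1 ∧
      padicEval (V.formalSigma c) ((p : ℚ_[p]) ^ 2 * u) =
        (p : ℚ_[p]) ^ 2 * u * NormedSpace.exp ((p : ℚ_[p]) * θ) := by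
  obtain ⟨Θ, hΘ, hΘ0, h⟩ := exists_dilation_formalSigma V hc
  refine ⟨padicEval Θ u, norm_padicEval_lt_one hΘ hΘ0 hu, ?_⟩
  have hFΘ : IsPadicInt ((rescale (p : ℚ_[p]) (exp ℚ_[p])).subst Θ) :=
    isPadicInt_rescale_exp.powerSeries_subst hΘ (HasSubst.of_constantCoeff_zero' hΘ0)
  rw [padicEval_mul_eq_padicEval_rescale, h, mul_assoc, padicEval_C_mul',
    padicEval_mul IsPadicInt.powerSeries_X hFΘ hu, padicEval_X,
    padicEval_subst isPadicInt_rescale_exp hΘ hΘ0 hu, padicEval_rescale_exp (norm_padicEval_lt_one hΘ hΘ0 hu)]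
  ring

/-- **`‖σ_c(t)‖ = ‖t‖` on `p²·(open unit disc)`** (`‖c‖ ≤ 1`); in particular `σ_c(t) ≠ 0` for `t ≠ 0` —
the non-vanishing hypothesis of the height difference law, DISCHARGED. [Bernardi 1981, §1]
[cite: Robert2000PadicAnalysis, Ch. V §4.2 Proposition 1] -/
theorem norm_padicEval_formalSigma {c : ℚ_[p]} (hc : ‖c‖ ≤ 1) {u : ℚ_[p]} (hu : ‖u‖ < 1) :
    ‖padicEval (V.formalSigma c) ((p : ℚ_[p]) ^ 2 * u)‖ = ‖(p : ℚ_[p]) ^ 2 * u‖ := by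
  obtain ⟨θ, hθ, h⟩ := exists_padicEval_formalSigma_eq V hc hu
  rw [h, norm_mul, norm_exp_of_norm_lt_radius (p := p) (norm_prime_mul_lt_radius hθ), mul_one]

/-- `σ_c(p²u) ≠ 0` for `0 < ‖u‖ < 1`, `‖c‖ ≤ 1`. [Bernardi 1981, §1] [cite: Robert2000PadicAnalysis, Ch. V §4.2 Proposition 1] -/
theorem padicEval_formalSigma_ne_zero {c : ℚ_[p]} (hc : ‖c‖ ≤ 1) {u : ℚ_[p]} (hu : ‖u‖ < 1) (hu0 : u ≠ 0) :
    padicEval (V.formalSigma c) ((p : ℚ_[p]) ^ 2 * u) ≠ 0 := by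
  have hp0 : (p : ℚ_[p]) ≠ 0 := by exact_mod_cast (Fact.out : p.Prime).ne_zero
  rw [← norm_pos_iff, norm_padicEval_formalSigma V hc hu, norm_pos_iff]
  exact mul_ne_zero (pow_ne_zero 2 hp0) hu0

end Bounds

end Summit.BirchSwinnertonDyer.BirchSwinnertonDyer.Theorems.PSSigmaLineFamilyConvergence

end
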